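/-
Copyright (c) 2026 the pub-hodgecm-mathlib formalisation cell (harness21).  Prover seat hodgecm-mathlib-K2-defs1 (g6), Track B, h413 = `stmt-HodgeConjecture-24833`, route `HCCMUnconditional`,
deal (270) of dealer K2E1-plan (g7) 2026-09-04T14:09:35Z (G4): GENERIC-EIGENVALUE EDITION 4 — CLOSER₂ (★ K2E1-p12 `K2E1MaassSelbergFamilyCMTwo`) with `ŝ_i(z)` for `∫ h_i·H^z`.
-/
import Summits.HodgeConjecture.HodgeConjecture.Theorems.K2E1MaassSelbergFamilyCMTwo   -- ★ p859643: the ĥ-currency CLOSER₂ and `exists_differentiableOn_of_local_ae_eq_within`; brings every brick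
import HarnessLib

/-!
# `K2E1MaassSelbergFamilyCMTwoEigen` — GENERIC-EIGENVALUE EDITION of ★ CLOSER₂ `exists_truncatedFamily_cm_two[_upper]`: the `L²(𝔛, μ)`-holomorphic family of truncated continued
# (χ,τ) Eisenstein series on `U ∖ P`, with the cover clause `hcov` and the pointwise representation (E5) in the EIGENVALUE currency `ŝ_j(z)` (entire, hypothesis `hŝ`)

Cell `pub/hodgecm-mathlib`, crux H413 = `stmt-HodgeConjecture-24833`.  THEOREMS ONLY (no `def`, no `instance`, no notation, no named-fact hypothesis, no `sorry`); lane `--supports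
stmt-HodgeConjecture-24833 --as helper` (count-neutral).  Closes no socket.  THIS FILE = ★'s two heads VERBATIM with `(∫ x, h j x * ↑↑(borelHeight x) ^ z ∂νG) ↦ ŝ j z` and the one use of ★
`differentiable_integral_mul_borelHeight_cpow` replaced by `hŝ j`; everything else (high-part operators, K1 at the system levels, `hid_of_unfolding`, gluing of the patches `U ∩ {ŝ_j ≠ 0}`)
unchanged.  Consumer: the level family export (G4). [BernsteinLapid2019, Thm 2.3, §4 Claims 4–5; MoeglinWaldspurger1995, I.2.13, IV.2.3]
* **`exists_truncatedFamily_cm_two_of_eigen`**, **`exists_truncatedFamily_cm_two_upper_of_eigen`**.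
HONEST LABEL: HC_CM is proved only modulo the 7 printed citations (2 remaining named inputs: hLiu418 = `stmt-HodgeConjecture-24832`, h413 = `stmt-HodgeConjecture-24833`) until rung 0
closes; count-neutral helper, closes no socket.

## References
* [BernsteinLapid2019] J. Bernstein, E. Lapid, *On the meromorphic continuation of Eisenstein series*, J. AMS 37 (2024), Thm 2.3, §4 Claims 4–5 (p. 10).
* [MoeglinWaldspurger1995] C. Mœglin, J.-L. Waldspurger, *Spectral Decomposition and Eisenstein Series* (1995), I.2.13, IV.2.3.
-/

set_option autoImplicit false
set_option linter.dupNamespace false  -- the mandated namespace repeats the summit's segment (`HodgeConjecture.HodgeConjecture`)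

noncomputable section

open MeasureTheory MeasureTheory.Measure Set NumberField IsDedekindDomain Filter Topology
open scoped NNReal ENNReal ComplexConjugate
open Literature.MeasureTheory.Group Literature.NumberTheory
open Literature.NumberTheory.Automorphic Literature.NumberTheory.Automorphic.UnitaryGroup AdelicGroupData
open Summit.HodgeConjecture.HodgeConjecture.Cruxes.H413.K2E1BLBorelSpacesU2Defs
open Summit.HodgeConjecture.HodgeConjecture.Cruxes.H413.K2E1BLBorelOperatorsU2Defs
open Summit.HodgeConjecture.HodgeConjecture.Cruxes.H413.K2E1BLIotaClosedEmbeddingU2 (iotaBound_cm isFiniteMeasure_weightedTruncMeasure_cm)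
open Summit.HodgeConjecture.HodgeConjecture.Cruxes.H413.K2E1BLQuotientMeasureU (measurePreserving_rightShift_of_unfolding)
open Summit.HodgeConjecture.HodgeConjecture.Cruxes.H413.K2E1BLShiftBoundU2 (shiftBound_of_isCompact)
open Summit.HodgeConjecture.HodgeConjecture.Cruxes.H413.K2E1IntertwinedSectionInvariance (map_conj_toAdelic_eq_self_two)
open Summit.HodgeConjecture.HodgeConjecture.Cruxes.H413.K2E1SphericalHeckeEigenSectionU2 (differentiable_integral_mul_borelHeight_cpow)
open Summit.HodgeConjecture.HodgeConjecture.Cruxes.H413.K2E1MaassSelbergFamilyPayerCMTwo (exists_lowPart_clm)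
open Summit.HodgeConjecture.HodgeConjecture.Cruxes.H413.K2E1MaassSelbergFamilyPayerNaturalCMTwo (exists_family_of_operator_letters')
open Summit.HodgeConjecture.HodgeConjecture.Cruxes.H413.K2E1BLHighPartOperatorU (exists_highPartOperator_two)
open Summit.HodgeConjecture.HodgeConjecture.Cruxes.H413.K2E1BLHighPartIdentificationU (hid_of_unfolding)
open Summit.HodgeConjecture.HodgeConjecture.Cruxes.H413.K2E1BLLiftIntegrabilityU (lift_quotientSubgroup_mul)

open Summit.HodgeConjecture.HodgeConjecture.Cruxes.H413.K2E1MaassSelbergFamilyCMTwo (exists_differentiableOn_of_local_ae_eq_within)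

namespace Summit.HodgeConjecture.HodgeConjecture.Cruxes.H413.K2E1MaassSelbergFamilyCMTwoEigen

section Closer

variable (L : Type) [Field L] [NumberField L] [IsCMField L]
  [MeasurableSpace (quasiSplit (↥(maximalRealSubfield L)) L (IsCMField.complexConj L) 2).Adelic] [BorelSpace (quasiSplit (↥(maximalRealSubfield L)) L (IsCMField.complexConj L) 2).Adelic]

/-! ## §0 Glue with local representatives differentiable within `D` -/

/-- **GENERIC-EIGENVALUE EDITION of ★ CLOSER₂ `exists_truncatedFamily_cm_two`**: `∃ T₀ ≥ 1, ∃ Fam, DifferentiableOn ℂ Fam (U ∖ P) ∧ ∀ z ∈ U ∖ P, Fam z =ᵐ[μ] quotFun (Λ^{T₀} (Ec z))`, with `hcov`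
and (E5) in the `ŝ`-currency. [cite: BernsteinLapid2019, Thm 2.3 and §4 Claims 4–5 (p. 10)] [cite: MoeglinWaldspurger1995, I.2.13, IV.2.3] -/
theorem exists_truncatedFamily_cm_two_of_eigen
    -- structural letters: the measures (as ★ X1)
    (μ : Measure (quasiSplit (↥(maximalRealSubfield L)) L (IsCMField.complexConj L) 2).automorphicQuotient) [(quasiSplit (↥(maximalRealSubfield L)) L (IsCMField.complexConj L) 2).IsAutomorphicMeasure μ]
    (νG : Measure (quasiSplit (↥(maximalRealSubfield L)) L (IsCMField.complexConj L) 2).Adelic) [νG.IsHaarMeasure] [νG.IsInvInvariant] [SFinite νG]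
    (ν : Measure ↥(adelicUnipotent (↥(maximalRealSubfield L)) L (IsCMField.complexConj L) 2)) [ν.IsHaarMeasure] [ν.IsMulRightInvariant] [ν.IsInvInvariant]
    {𝓕 : Set ↥(adelicUnipotent (↥(maximalRealSubfield L)) L (IsCMField.complexConj L) 2)}
    (h𝓕N : IsFundamentalDomain ↥(rationalUnipotent (↥(maximalRealSubfield L)) L (IsCMField.complexConj L) 2) 𝓕 ν) (h𝓕c : IsCompact (closure 𝓕)) (h𝓕₀ : ν 𝓕 ≠ 0)
    {β : (quasiSplit (↥(maximalRealSubfield L)) L (IsCMField.complexConj L) 2).Adelic → ℝ≥0∞}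
    (hβ : IsCoveringWeight ↥((arithmeticBorel (↥(maximalRealSubfield L)) L (IsCMField.complexConj L) 2).map (quasiSplit (↥(maximalRealSubfield L)) L (IsCMField.complexConj L) 2).arithmeticSubgroup.subtype) β)
    {μZ : Measure (borelQuotient (↥(maximalRealSubfield L)) L (IsCMField.complexConj L) 2)} [SFinite μZ]
    (hμZ : ∀ f : borelQuotient (↥(maximalRealSubfield L)) L (IsCMField.complexConj L) 2 → ℝ≥0∞, Measurable f → ∫⁻ z, f z ∂μZ = ∫⁻ g, β g * f (toBorelQuotient (↥(maximalRealSubfield L)) L (IsCMField.complexConj L) 2 g) ∂νG)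
    -- X1's per-ball objects (ball `D_n = ball 0 (n+2)`, weight `k = n + 3`)
    (n : ℕ) {I : Type} [Fintype I] (η : I → GL (Fin 2) (AdeleRing (𝓞 L) L) → ℝ) (h : I → (quasiSplit (↥(maximalRealSubfield L)) L (IsCMField.complexConj L) 2).Adelic → ℂ)
    (ŝ : I → ℂ → ℂ) (hŝ : ∀ i, Differentiable ℂ (ŝ i)) (a : ℝ≥0) (κ : I → ℝ≥0)
    (T : I → HX (↥(maximalRealSubfield L)) L (IsCMField.complexConj L) 2 (n + 3) μ →L[ℂ] HX (↥(maximalRealSubfield L)) L (IsCMField.complexConj L) 2 (n + 3) μ) (U : Set ℂ)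
    (vX : ℂ → HX (↥(maximalRealSubfield L)) L (IsCMField.complexConj L) 2 (n + 3) μ)
    -- X1's clauses (only those used)
    (hη : ∀ i, IsTestFunctionGL 2 L (η i))
    (hdef : ∀ i, h i = fun y : (quasiSplit (↥(maximalRealSubfield L)) L (IsCMField.complexConj L) 2).Adelic => orbitalSmoothing νG (fun x : (quasiSplit (↥(maximalRealSubfield L)) L (IsCMField.complexConj L) 2).Adelic => ((η i (adelicVal (↥(maximalRealSubfield L)) L (IsCMField.complexConj L) 2 ((StdForm.antidiagonal 2).over L) x) : ℝ) : ℂ)) (fun x : (quasiSplit (↥(maximalRealSubfield L)) L (IsCMField.complexConj L) 2).Adelic => ((η i (adelicVal (↥(maximalRealSubfield L)) L (IsCMField.complexConj L) 2 ((StdForm.antidiagonal 2).over L) x) : ℝ) : ℂ)) y)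
    (hreg : ∀ i, Continuous (h i) ∧ HasCompactSupport (h i))
    (hcov : ∀ z ∈ Metric.ball (0 : ℂ) (n + 2), ∃ i, (ŝ i z) ≠ 0)
    (ha : 0 < a) (hκ : ∀ i, 1 ≤ κ i)
    (hΩ : ∀ i, ∀ z : borelQuotient (↥(maximalRealSubfield L)) L (IsCMField.complexConj L) 2, ∀ y ∈ tsupport (h i), borelQuotHeight (↥(maximalRealSubfield L)) L (IsCMField.complexConj L) 2 z ≤ κ i * borelQuotHeight (↥(maximalRealSubfield L)) L (IsCMField.complexConj L) 2 (rightShift (↥(maximalRealSubfield L)) L (IsCMField.complexConj L) 2 y z))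
    (hTX : ∀ i, ∀ u : HX (↥(maximalRealSubfield L)) L (IsCMField.complexConj L) 2 (n + 3) μ, (T i u : (quasiSplit (↥(maximalRealSubfield L)) L (IsCMField.complexConj L) 2).automorphicQuotient → ℂ) =ᵐ[μ.withDensity fun x => (((supHeight (↥(maximalRealSubfield L)) L (IsCMField.complexConj L) 2 x)⁻¹ ^ (2 * (n + 3)) : ℝ≥0) : ℝ≥0∞)]
      fun ξ => ∫ y, h i y * (u : (quasiSplit (↥(maximalRealSubfield L)) L (IsCMField.complexConj L) 2).automorphicQuotient → ℂ) (y⁻¹ • ξ) ∂νG)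
    (hUo : IsOpen U) (hUD : U ⊆ Metric.ball (0 : ℂ) (n + 2)) (hvX : DifferentiableOn ℂ vX U)
    -- the global continued function, the exceptional set, and the pointwise representation (E5) (★ X2)
    (Ec : ℂ → (quasiSplit (↥(maximalRealSubfield L)) L (IsCMField.complexConj L) 2).Adelic → ℂ) (P : Set ℂ)
    (hE5 : ∀ j, ∀ z ∈ U, z ∉ P → (ŝ j z) ≠ 0 → ∀ g : (quasiSplit (↥(maximalRealSubfield L)) L (IsCMField.complexConj L) 2).Adelic,
      Ec z g = (ŝ j z)⁻¹ *
        ∫ y, h j y * ((vX z : HX (↥(maximalRealSubfield L)) L (IsCMField.complexConj L) 2 (n + 3) μ) : (quasiSplit (↥(maximalRealSubfield L)) L (IsCMField.complexConj L) 2).automorphicQuotient → ℂ)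
          ((quasiSplit (↥(maximalRealSubfield L)) L (IsCMField.complexConj L) 2).toAutomorphicQuotient (g * y)⁻¹) ∂νG) :
    ∃ T₀ : ℝ≥0, 1 ≤ T₀ ∧ ∃ Fam : ℂ → Lp ℂ 2 μ, DifferentiableOn ℂ Fam (U \ P) ∧
      ∀ z ∈ U \ P, ((Fam z : Lp ℂ 2 μ) : (quasiSplit (↥(maximalRealSubfield L)) L (IsCMField.complexConj L) 2).automorphicQuotient → ℂ) =ᵐ[μ]
        (quasiSplit (↥(maximalRealSubfield L)) L (IsCMField.complexConj L) 2).quotFun (truncation ν 𝓕 T₀ (Ec z)) := by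
  classical
  -- involution facts, structural consequences
  have hc : IsCMField.complexConj L * IsCMField.complexConj L = 1 :=
    AlgEquiv.ext fun x => by rw [AlgEquiv.mul_apply, AlgEquiv.one_apply, IsCMField.complexConj_apply_apply]
  have hc1 : IsCMField.complexConj L ≠ 1 := IsCMField.complexConj_ne_one L
  have h𝓕top : ν 𝓕 ≠ ∞ := ((measure_mono subset_closure).trans_lt h𝓕c.measure_lt_top).ne
  haveI : νG.IsMulRightInvariant := by rw [← Measure.inv_eq_self νG]; infer_instance
  have hright := measurePreserving_rightShift_of_unfolding νG hβ hμZ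
  letI : MeasurableSpace (AdeleRing (𝓞 L) L) := borel _
  haveI : BorelSpace (AdeleRing (𝓞 L) L) := ⟨rfl⟩
  have hconj := fun b₀ (hb₀ : b₀ ∈ borelU (IsCMField.complexConj L : L →+* L) ((StdForm.antidiagonal 2).over L)) => map_conj_toAdelic_eq_self_two hc hc1 ν hb₀
  -- the test functions: `h = S_η η`, continuity, compact support
  have hfun : h = fun i => fun y : (quasiSplit (↥(maximalRealSubfield L)) L (IsCMField.complexConj L) 2).Adelic => orbitalSmoothing νG (fun x : (quasiSplit (↥(maximalRealSubfield L)) L (IsCMField.complexConj L) 2).Adelic => ((η i (adelicVal (↥(maximalRealSubfield L)) L (IsCMField.complexConj L) 2 ((StdForm.antidiagonal 2).over L) x) : ℝ) : ℂ)) (fun x : (quasiSplit (↥(maximalRealSubfield L)) L (IsCMField.complexConj L) 2).Adelic => ((η i (adelicVal (↥(maximalRealSubfield L)) L (IsCMField.complexConj L) 2 ((StdForm.antidiagonal 2).over L) x) : ℝ) : ℂ)) y :=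
    funext hdef
  have hhc : ∀ i, Continuous (h i) := fun i => (hreg i).1
  have hhs : ∀ i, HasCompactSupport (h i) := fun i => (hreg i).2
  -- levels: the pull-back letter at `a`, the shift constants `κ'_j`, and ONE common upper level `T₀`
  have hb : IotaBound (↥(maximalRealSubfield L)) L (IsCMField.complexConj L) 2 (n + 3) a μ μZ := iotaBound_cm L μ νG hβ hμZ ha (n + 3)
  haveI : IsFiniteMeasure (weightedTruncMeasure (↥(maximalRealSubfield L)) L (IsCMField.complexConj L) 2 (n + 3) a μZ) := isFiniteMeasure_weightedTruncMeasure_cm L μ νG hβ hμZ ha (n + 3)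
  have hSB : ∀ j, ∃ κ' : ℝ≥0, 1 ≤ κ' ∧ ∀ (k : ℕ) (c₁ c₀ : ℝ≥0), κ' * c₁ ≤ c₀ →
      ∀ h' : (quasiSplit (↥(maximalRealSubfield L)) L (IsCMField.complexConj L) 2).Adelic → ℂ, Measurable h' → Integrable h' νG → (∀ y, y ∉ tsupport (h j) → h' y = 0) →
        ShiftBound (↥(maximalRealSubfield L)) L (IsCMField.complexConj L) 2 k c₁ c₀ νG μZ h' := fun j =>
    shiftBound_of_isCompact (νG := νG) (μZ := μZ) hright (hhs j).isCompact
  choose κ' hκ'1 hκ' using hSB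
  set T₀ : ℝ≥0 := max 1 (Finset.univ.sup fun j => max (κ' j) (κ j) * a) with hT₀def
  have hT₀1 : 1 ≤ T₀ := le_max_left _ _
  have hT₀pos : 0 < T₀ := lt_of_lt_of_le one_pos hT₀1
  have hκT : ∀ j, κ j * a ≤ T₀ := fun j =>
    ((mul_le_mul_of_nonneg_right (le_max_right (κ' j) (κ j)) zero_le).trans (Finset.le_sup (f := fun j => max (κ' j) (κ j) * a) (Finset.mem_univ j))).trans (le_max_right _ _)
  have hκ'T : ∀ j, κ' j * a ≤ T₀ := fun j =>
    ((mul_le_mul_of_nonneg_right (le_max_left (κ' j) (κ j)) zero_le).trans (Finset.le_sup (f := fun j => max (κ' j) (κ j) * a) (Finset.mem_univ j))).trans (le_max_right _ _)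
  haveI : IsFiniteMeasure (weightedTruncMeasure (↥(maximalRealSubfield L)) L (IsCMField.complexConj L) 2 0 T₀ μZ) := isFiniteMeasure_weightedTruncMeasure_cm L μ νG hβ hμZ hT₀pos 0
  -- the shift letters at `(a, T₀)`
  have hs : ∀ j, ShiftBound (↥(maximalRealSubfield L)) L (IsCMField.complexConj L) 2 (n + 3) a T₀ νG μZ (h j) := fun j =>
    hκ' j (n + 3) a T₀ (hκ'T j) (h j) (hhc j).measurable ((hhc j).integrable_of_hasCompactSupport (hhs j)) fun y hy => image_eq_zero_of_notMem_tsupport hy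
  -- K2's cusp decay at `(a, T₀)` for `h_j = S_{η_j} η_j` (★ `hK1_cm_two_of` ∘ ★ K2-defs1 (ii) ∘ ★ product formula), `m = 0`
  have hK1 : ∀ j, ∃ C : ℝ, 0 ≤ C ∧ ∀ f : HNcusp (↥(maximalRealSubfield L)) L (IsCMField.complexConj L) 2 (n + 3) a μZ,
      ∀ᵐ z ∂(weightedTruncMeasure (↥(maximalRealSubfield L)) L (IsCMField.complexConj L) 2 (n + 3) T₀ μZ),
        ‖rightConvFun (↥(maximalRealSubfield L)) L (IsCMField.complexConj L) 2 νG (h j) ((f : HN (↥(maximalRealSubfield L)) L (IsCMField.complexConj L) 2 (n + 3) a μZ) : borelQuotient (↥(maximalRealSubfield L)) L (IsCMField.complexConj L) 2 → ℂ) z‖ ≤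
          C * ‖f‖ * ((borelQuotHeight (↥(maximalRealSubfield L)) L (IsCMField.complexConj L) 2 z : ℝ)) ^ (-(0 : ℝ)) := by
    intro j
    subst hfun
    exact K2E1TruncatedCuspDecayHK1CMTwo.hK1_cm_two_of L μZ νG hβ hμZ (hη j) (n + 3) a T₀ hT₀pos
      (fun νN _ _ _ 𝓕N h𝓕 h0 htop f => K2E1TruncatedCuspConstantTermAEU2.ae_borelConstantTerm_indicator_comp_eq_zero_of_mem_HNcusp νG νN
        (fun _ hb₀ => map_conj_toAdelic_eq_self_two hc hc1 νN hb₀) h𝓕 h0 htop hβ hμZ (n + 3) a f)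
      (lt_of_lt_of_le zero_lt_one (hκ j)) (hκT j) (hΩ j) (m := 0) le_rfl
  choose C hC hK1' using hK1
  -- the high-part operators `K_j` ((O2c) ★ with `hid` ★), the low cut-off `A` ((O1) ★)
  have hK : ∀ j, ∃ K : HX (↥(maximalRealSubfield L)) L (IsCMField.complexConj L) 2 (n + 3) μ →L[ℂ] Lp ℂ 2 μ, ∀ u : HX (↥(maximalRealSubfield L)) L (IsCMField.complexConj L) 2 (n + 3) μ, ∀ᵐ x ∂μ,
      (supHeight (↥(maximalRealSubfield L)) L (IsCMField.complexConj L) 2 x ≤ T₀ → ((K u : Lp ℂ 2 μ) : (quasiSplit (↥(maximalRealSubfield L)) L (IsCMField.complexConj L) 2).automorphicQuotient → ℂ) x = 0) ∧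
      ∀ g : (quasiSplit (↥(maximalRealSubfield L)) L (IsCMField.complexConj L) 2).Adelic, (quasiSplit (↥(maximalRealSubfield L)) L (IsCMField.complexConj L) 2).toAutomorphicQuotient g⁻¹ = x → T₀ < borelHeight g →
        ((K u : Lp ℂ 2 μ) : (quasiSplit (↥(maximalRealSubfield L)) L (IsCMField.complexConj L) 2).automorphicQuotient → ℂ) x =
          (∫ y, h j y * (u : (quasiSplit (↥(maximalRealSubfield L)) L (IsCMField.complexConj L) 2).automorphicQuotient → ℂ) ((quasiSplit (↥(maximalRealSubfield L)) L (IsCMField.complexConj L) 2).toAutomorphicQuotient (g * y)⁻¹) ∂νG) -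
            borelConstantTerm ν 𝓕 (fun x' => ∫ y, h j y * (u : (quasiSplit (↥(maximalRealSubfield L)) L (IsCMField.complexConj L) 2).automorphicQuotient → ℂ) ((quasiSplit (↥(maximalRealSubfield L)) L (IsCMField.complexConj L) 2).toAutomorphicQuotient (x' * y)⁻¹) ∂νG) g := fun j =>
    exists_highPartOperator_two μ νG hβ hμZ hT₀1 hb (hs j) (hC j) le_rfl (hK1' j) le_rfl ν 𝓕
      fun u => hid_of_unfolding νG ν hconj h𝓕N h𝓕₀ h𝓕top hβ hμZ μ h𝓕c hb (hhc j) (hhs j) (lt_of_lt_of_le zero_lt_one (hκ j)) (hκT j) (hΩ j) (hs j) le_rfl u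
  choose K hKspec using hK
  obtain ⟨A, hA, -⟩ := exists_lowPart_clm (F := ↥(maximalRealSubfield L)) (E := L) (c := IsCMField.complexConj L) (N := 2) (n + 3) T₀ μ
  -- the eigenvalue functions `ŝ_j`: entire (hypothesis `hŝ`)
  have hĥd : ∀ j, Differentiable ℂ fun z : ℂ => ŝ j z := fun j => hŝ j
  -- the family on `U ∖ P`, glued from the patches `V_j := U ∩ {ĥ_j ≠ 0}`
  refine ⟨T₀, hT₀1, exists_differentiableOn_of_local_ae_eq_within _ fun z₀ hz₀ => ?_⟩
  obtain ⟨j, hj⟩ := hcov z₀ (hUD hz₀.1)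
  set V : Set ℂ := U ∩ {z : ℂ | (ŝ j z) ≠ 0} with hVdef
  have hVo : IsOpen V := hUo.inter (isOpen_ne_fun (hĥd j).continuous continuous_const)
  have hz₀V : z₀ ∈ V := ⟨hz₀.1, hj⟩
  -- the natural payer on `D := V ∩ (U ∖ P)`
  have hEcinv : ∀ z ∈ V ∩ (U \ P), ∀ γ : (quasiSplit (↥(maximalRealSubfield L)) L (IsCMField.complexConj L) 2).arithmeticSubgroup, ∀ x : (quasiSplit (↥(maximalRealSubfield L)) L (IsCMField.complexConj L) 2).Adelic,
      Ec z ((γ : (quasiSplit (↥(maximalRealSubfield L)) L (IsCMField.complexConj L) 2).Adelic) * x) = Ec z x := by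
    intro z hz γ x
    rw [hE5 j z hz.1.1 hz.2.2 hz.1.2 ((γ : (quasiSplit (↥(maximalRealSubfield L)) L (IsCMField.complexConj L) 2).Adelic) * x), hE5 j z hz.1.1 hz.2.2 hz.1.2 x]
    congr 1
    refine integral_congr_ae (Eventually.of_forall fun y => ?_)
    show h j y * _ = h j y * _
    rw [mul_assoc, lift_quotientSubgroup_mul ((vX z : HX (↥(maximalRealSubfield L)) L (IsCMField.complexConj L) 2 (n + 3) μ) : (quasiSplit (↥(maximalRealSubfield L)) L (IsCMField.complexConj L) 2).automorphicQuotient → ℂ)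
      (γ : (quasiSplit (↥(maximalRealSubfield L)) L (IsCMField.complexConj L) 2).Adelic) ((quasiSplit (↥(maximalRealSubfield L)) L (IsCMField.complexConj L) 2).arithmeticSubgroup_le_quotientSubgroup γ.2) (x * y)]
  obtain ⟨Fam, hFd, hFam⟩ := exists_family_of_operator_letters' ν h𝓕N hT₀1 (n + 3) μ νG (h j) (D := V ∩ (U \ P)) vX (hvX.mono fun z hz => hz.1.1)
    (fun z : ℂ => ŝ j z) ((hĥd j).differentiableOn.mono (subset_univ _)) (fun z hz => hz.1.2)
    Ec hEcinv (fun z hz g => hE5 j z hz.1.1 hz.2.2 hz.1.2 g) (T j) (hTX j) A hA (K j) (hKspec j)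
  exact ⟨V, hVo.mem_nhds hz₀V, Fam, hFd, hFam⟩

/-- **CLOSER₂ ON THE UPPER DOMAIN `D₁ := (D⁺ ∩ D_n ∩ U) ∖ P`** (dealer K2E1-plan (g6) (120) bytes): the family of `exists_truncatedFamily_cm_two` restricted to
`D₁ = ({z | 1 < z.re ∧ 0 < z.im} ∩ ball 0 (n+2) ∩ U) ∖ P` — the `(F, hFd)` of ★ p859607 `poleControl_continued_cm_two_of_family_on'` at this `D₁`, `hFtube` following from (E1)
`Ec z = E(φ₀H^z)` on the tube. [cite: BernsteinLapid2019, §4 Claims 4–5 (p. 10)] [cite: MoeglinWaldspurger1995, IV.2.3, IV.3.12 (a)] -/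
theorem exists_truncatedFamily_cm_two_upper_of_eigen
    (μ : Measure (quasiSplit (↥(maximalRealSubfield L)) L (IsCMField.complexConj L) 2).automorphicQuotient) [(quasiSplit (↥(maximalRealSubfield L)) L (IsCMField.complexConj L) 2).IsAutomorphicMeasure μ]
    (νG : Measure (quasiSplit (↥(maximalRealSubfield L)) L (IsCMField.complexConj L) 2).Adelic) [νG.IsHaarMeasure] [νG.IsInvInvariant] [SFinite νG]
    (ν : Measure ↥(adelicUnipotent (↥(maximalRealSubfield L)) L (IsCMField.complexConj L) 2)) [ν.IsHaarMeasure] [ν.IsMulRightInvariant] [ν.IsInvInvariant]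
    {𝓕 : Set ↥(adelicUnipotent (↥(maximalRealSubfield L)) L (IsCMField.complexConj L) 2)}
    (h𝓕N : IsFundamentalDomain ↥(rationalUnipotent (↥(maximalRealSubfield L)) L (IsCMField.complexConj L) 2) 𝓕 ν) (h𝓕c : IsCompact (closure 𝓕)) (h𝓕₀ : ν 𝓕 ≠ 0)
    {β : (quasiSplit (↥(maximalRealSubfield L)) L (IsCMField.complexConj L) 2).Adelic → ℝ≥0∞}
    (hβ : IsCoveringWeight ↥((arithmeticBorel (↥(maximalRealSubfield L)) L (IsCMField.complexConj L) 2).map (quasiSplit (↥(maximalRealSubfield L)) L (IsCMField.complexConj L) 2).arithmeticSubgroup.subtype) β)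
    {μZ : Measure (borelQuotient (↥(maximalRealSubfield L)) L (IsCMField.complexConj L) 2)} [SFinite μZ]
    (hμZ : ∀ f : borelQuotient (↥(maximalRealSubfield L)) L (IsCMField.complexConj L) 2 → ℝ≥0∞, Measurable f → ∫⁻ z, f z ∂μZ = ∫⁻ g, β g * f (toBorelQuotient (↥(maximalRealSubfield L)) L (IsCMField.complexConj L) 2 g) ∂νG)
    (n : ℕ) {I : Type} [Fintype I] (η : I → GL (Fin 2) (AdeleRing (𝓞 L) L) → ℝ) (h : I → (quasiSplit (↥(maximalRealSubfield L)) L (IsCMField.complexConj L) 2).Adelic → ℂ)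
    (ŝ : I → ℂ → ℂ) (hŝ : ∀ i, Differentiable ℂ (ŝ i)) (a : ℝ≥0) (κ : I → ℝ≥0)
    (T : I → HX (↥(maximalRealSubfield L)) L (IsCMField.complexConj L) 2 (n + 3) μ →L[ℂ] HX (↥(maximalRealSubfield L)) L (IsCMField.complexConj L) 2 (n + 3) μ) (U : Set ℂ)
    (vX : ℂ → HX (↥(maximalRealSubfield L)) L (IsCMField.complexConj L) 2 (n + 3) μ)
    (hη : ∀ i, IsTestFunctionGL 2 L (η i))
    (hdef : ∀ i, h i = fun y : (quasiSplit (↥(maximalRealSubfield L)) L (IsCMField.complexConj L) 2).Adelic => orbitalSmoothing νG (fun x : (quasiSplit (↥(maximalRealSubfield L)) L (IsCMField.complexConj L) 2).Adelic => ((η i (adelicVal (↥(maximalRealSubfield L)) L (IsCMField.complexConj L) 2 ((StdForm.antidiagonal 2).over L) x) : ℝ) : ℂ)) (fun x : (quasiSplit (↥(maximalRealSubfield L)) L (IsCMField.complexConj L) 2).Adelic => ((η i (adelicVal (↥(maximalRealSubfield L)) L (IsCMField.complexConj L) 2 ((StdForm.antidiagonal 2).over L) x) : ℝ) : ℂ))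 y)
    (hreg : ∀ i, Continuous (h i) ∧ HasCompactSupport (h i))
    (hcov : ∀ z ∈ Metric.ball (0 : ℂ) (n + 2), ∃ i, (ŝ i z) ≠ 0)
    (ha : 0 < a) (hκ : ∀ i, 1 ≤ κ i)
    (hΩ : ∀ i, ∀ z : borelQuotient (↥(maximalRealSubfield L)) L (IsCMField.complexConj L) 2, ∀ y ∈ tsupport (h i), borelQuotHeight (↥(maximalRealSubfield L)) L (IsCMField.complexConj L) 2 z ≤ κ i * borelQuotHeight (↥(maximalRealSubfield L)) L (IsCMField.complexConj L) 2 (rightShift (↥(maximalRealSubfield L)) L (IsCMField.complexConj L) 2 y z))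
    (hTX : ∀ i, ∀ u : HX (↥(maximalRealSubfield L)) L (IsCMField.complexConj L) 2 (n + 3) μ, (T i u : (quasiSplit (↥(maximalRealSubfield L)) L (IsCMField.complexConj L) 2).automorphicQuotient → ℂ) =ᵐ[μ.withDensity fun x => (((supHeight (↥(maximalRealSubfield L)) L (IsCMField.complexConj L) 2 x)⁻¹ ^ (2 * (n + 3)) : ℝ≥0) : ℝ≥0∞)]
      fun ξ => ∫ y, h i y * (u : (quasiSplit (↥(maximalRealSubfield L)) L (IsCMField.complexConj L) 2).automorphicQuotient → ℂ) (y⁻¹ • ξ) ∂νG)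
    (hUo : IsOpen U) (hUD : U ⊆ Metric.ball (0 : ℂ) (n + 2)) (hvX : DifferentiableOn ℂ vX U)
    (Ec : ℂ → (quasiSplit (↥(maximalRealSubfield L)) L (IsCMField.complexConj L) 2).Adelic → ℂ) (P : Set ℂ)
    (hE5 : ∀ j, ∀ z ∈ U, z ∉ P → (ŝ j z) ≠ 0 → ∀ g : (quasiSplit (↥(maximalRealSubfield L)) L (IsCMField.complexConj L) 2).Adelic,
      Ec z g = (ŝ j z)⁻¹ *
        ∫ y, h j y * ((vX z : HX (↥(maximalRealSubfield L)) L (IsCMField.complexConj L) 2 (n + 3) μ) : (quasiSplit (↥(maximalRealSubfield L)) L (IsCMField.complexConj L) 2).automorphicQuotient → ℂ)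
          ((quasiSplit (↥(maximalRealSubfield L)) L (IsCMField.complexConj L) 2).toAutomorphicQuotient (g * y)⁻¹) ∂νG) :
    ∃ T₀ : ℝ≥0, 1 ≤ T₀ ∧ ∃ Fam : ℂ → Lp ℂ 2 μ, DifferentiableOn ℂ Fam (({z : ℂ | 1 < z.re ∧ 0 < z.im} ∩ Metric.ball (0 : ℂ) (n + 2) ∩ U) \ P) ∧
      ∀ z ∈ ({z : ℂ | 1 < z.re ∧ 0 < z.im} ∩ Metric.ball (0 : ℂ) (n + 2) ∩ U) \ P,
        ((Fam z : Lp ℂ 2 μ) : (quasiSplit (↥(maximalRealSubfield L)) L (IsCMField.complexConj L) 2).automorphicQuotient → ℂ) =ᵐ[μ]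
          (quasiSplit (↥(maximalRealSubfield L)) L (IsCMField.complexConj L) 2).quotFun (truncation ν 𝓕 T₀ (Ec z)) := by
  obtain ⟨T₀, hT₀, Fam, hFd, hFam⟩ := exists_truncatedFamily_cm_two_of_eigen L μ νG ν h𝓕N h𝓕c h𝓕₀ hβ hμZ n η h ŝ hŝ a κ T U vX hη hdef hreg hcov ha hκ hΩ hTX hUo hUD hvX Ec P hE5
  have hsub : ({z : ℂ | 1 < z.re ∧ 0 < z.im} ∩ Metric.ball (0 : ℂ) (n + 2) ∩ U) \ P ⊆ U \ P := fun z hz => ⟨hz.1.2, hz.2⟩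
  exact ⟨T₀, hT₀, Fam, hFd.mono hsub, fun z hz => hFam z (hsub hz)⟩

end Closer

end Summit.HodgeConjecture.HodgeConjecture.Cruxes.H413.K2E1MaassSelbergFamilyCMTwoEigen
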